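import Summits.QuantumFields.YangMills.Theorems.SwapVirialDeficitZeroModeGroupThreeLaplaceRateWeights
import Summits.QuantumFields.YangMills.Theorems.SwapVirialDeficitZeroModeGroupThreeSmallBallRateLayers
import HarnessLib

/-!
# Exact zero-mode rung on the GROUP, three letters, Laplace form — VIII: the thin-layer term `Δ₂` of the rate
# (free-hands support of ⟨stmt-QuantumFields-24197⟩; quantifies w2 g55's chain I–V toward `|β²Λ₃(β) − v₃| ≤ K·β^{−θ}`)

Part VI bounded `h_0 − h_s ≤ Δ₁ + Δ₂` where `Δ₂ = (𝟙_{layer s}(x)𝟙(y) + 𝟙(x)𝟙_{layer s}(y))·e^{−gexp}` collects the points where a rescaled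
ball indicator flips: `layer s = {N_0 < 1 ≤ N_s} = {1 − x_I² − s(x_J²+x_K²) ≤ x₀² < 1 − x_I²}` — a thin QUADRATIC LAYER in the single
coordinate `x₀`, of length `≤ min(2, 2√(s(x_J²+x_K²)))` (✓`volume_sq_layer_le`, fcl-p3 g44).  Integrating `x₀` first (Tonelli with the
longitudinal pair innermost) and paying the moment `(x_J²+x_K²)^{3θ}` with half the transverse Gaussian exactly as in part VII:
* §1 ★ `volume_Lset_le` — `vol{t | t² + a < 1 ≤ t² + a + ε} ≤ 2ε^p` for `0 ≤ a`, `0 ≤ ε`, `0 < p ≤ 1/2`;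
* §2 the majorant `rateΦB` of the `x`-layer half of `Δ₂` in the pair frame, ★ `layerX_le_rateΦB`;
* §3 ★★ `lintegral_rateΦB_le` — `∫ rateΦB ≤ 4·s^{p}·16(r²)^{−2p}·(π²/48)(r²)^{−4/3}·I(1/3)²` (`p = 3θ`), via ✓`lintegral_rateΦA_inner_le`;
* §4 the `y`-layer half by the swap symmetry `gexp r x y = gexp r y x`, and ★★ `lintegral_rateΔ₂_le`.
HONEST LABEL: finite-dimensional real analysis (plan-level zero-mode rung of a DRAFT line «sharp-sigma»); NOT the fixed-`L` sharp law, NOT ⟨24197⟩;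
the Yang–Mills mass gap is NOT proved; no summit is proved by a line.  Width seat ym-line-sfw-p2-w2 g56 (cell ym-idea-1, free hands; own crux
⟨22884⟩ blocked-on ⟨19935⟩), `--supports stmt-QuantumFields-24197`.  Standard axioms, 0 `sorry`.  References: [cite: GonzalezarroyoAltes1988];
[cite: Vanbaal2001]; [folklore].
-/

set_option autoImplicit false

noncomputable section

open MeasureTheory Quaternion Set Filter Topology
open scoped Quaternion ENNReal
open Literature.MathematicalPhysics.QuantumLattice
open Summit.QuantumFields.YangMills.Theorems.SwapTwistDeficit.ToronLog

attribute [local instance] Literature.Analysis.FluidPDE.Tao2016.quatMeasurableSpace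
  Literature.Analysis.FluidPDE.Tao2016.quatBorelSpace
  Literature.MathematicalPhysics.QuantumLattice.secondCountableTopology_su2

namespace Summit.QuantumFields.YangMills.Theorems.SwapVirialDeficit.ZeroModeGroup

/-! ## §1 The `x₀`-section of the layer and its length -/

/-- The `x₀`-section of the layer at longitudinal offset `a = x_I²` and transverse budget `ε = s(x_J²+x_K²)`:
`Lset a ε = {t | t² + a < 1 ∧ 1 ≤ t² + a + ε}`. [folklore] -/
def Lset (a ε : ℝ) : Set ℝ := {t : ℝ | t ^ 2 + a < 1 ∧ 1 ≤ t ^ 2 + a + ε}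

/-- Membership in `Lset`. [folklore] -/
theorem mem_Lset (a ε t : ℝ) : t ∈ Lset a ε ↔ t ^ 2 + a < 1 ∧ 1 ≤ t ^ 2 + a + ε := Iff.rfl

/-- `Lset` is measurable. [folklore] -/
theorem measurableSet_Lset (a ε : ℝ) : MeasurableSet (Lset a ε) := by
  unfold Lset
  exact (measurableSet_lt (by fun_prop : Measurable fun t : ℝ => t ^ 2 + a) measurable_const).inter
    (measurableSet_le measurable_const (by fun_prop : Measurable fun t : ℝ => t ^ 2 + a + ε))

/-- `vol(Lset a ε) ≤ 2√ε` (a quadratic layer of width `ε`). [folklore] -/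
theorem volume_Lset_le_sqrt (a : ℝ) {ε : ℝ} (hε : 0 ≤ ε) : (volume : Measure ℝ) (Lset a ε) ≤ ENNReal.ofReal (2 * Real.sqrt ε) := by
  refine le_trans (measure_mono fun t ht => ?_) (volume_sq_layer_le (1 - a - ε) hε)
  rw [mem_Lset] at ht
  exact ⟨by linarith [ht.2], by linarith [ht.1]⟩

/-- `vol(Lset a ε) ≤ 2` for `a ≥ 0` (it lies in `{t² < 1}`). [folklore] -/
theorem volume_Lset_le_two {a : ℝ} (ha : 0 ≤ a) (ε : ℝ) : (volume : Measure ℝ) (Lset a ε) ≤ 2 := by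
  rw [← volume_sqBox_one]
  refine measure_mono fun t ht => ?_
  rw [mem_Lset] at ht
  show t ^ 2 < 1; linarith [ht.1]

/-- ★ **Thin layer with a power**: `vol(Lset a ε) ≤ 2ε^p` for `0 ≤ a`, `0 ≤ ε`, `0 < p ≤ 1/2` (`min(2, 2√ε) ≤ 2ε^p`). [folklore] -/
theorem volume_Lset_le {a ε p : ℝ} (ha : 0 ≤ a) (hε : 0 ≤ ε) (hp : 0 < p) (hp2 : p ≤ 1 / 2) :
    (volume : Measure ℝ) (Lset a ε) ≤ ENNReal.ofReal (2 * ε ^ p) := by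
  rcases le_or_gt ε 1 with h | h
  · refine (volume_Lset_le_sqrt a hε).trans (ENNReal.ofReal_le_ofReal ?_)
    rw [Real.sqrt_eq_rpow]
    exact mul_le_mul_of_nonneg_left (Real.rpow_le_rpow_of_exponent_ge' hε h hp.le hp2) (by norm_num)
  · refine (volume_Lset_le_two ha ε).trans ?_
    have h1 : (1:ℝ) ≤ ε ^ p := Real.one_le_rpow h.le hp.le
    have : (2 : ℝ≥0∞) = ENNReal.ofReal 2 := by rw [ENNReal.ofReal_ofNat]
    rw [this]
    exact ENNReal.ofReal_le_ofReal (by linarith)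

/-! ## §2 The majorant of the `x`-layer half of `Δ₂` in the pair frame -/

/-- The layer set in the pair frame `w = ((x₀,y₀),((x_I,y_I),((x_J,y_J),(x_K,y_K))))`:
`{x₀² + x_I² < 1 ≤ x₀² + x_I² + s(x_J² + x_K²)}`. [folklore] -/
def layerW (s : ℝ) : Set ((ℝ × ℝ) × ((ℝ × ℝ) × ((ℝ × ℝ) × (ℝ × ℝ)))) :=
  {w | w.1.1 ^ 2 + w.2.1.1 ^ 2 < 1 ∧ 1 ≤ w.1.1 ^ 2 + w.2.1.1 ^ 2 + s * (w.2.2.1.1 ^ 2 + w.2.2.2.1 ^ 2)}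

/-- `layerW` is measurable. [folklore] -/
theorem measurableSet_layerW (s : ℝ) : MeasurableSet (layerW s) := by
  unfold layerW
  exact (measurableSet_lt (by fun_prop : Measurable fun w : (ℝ × ℝ) × ((ℝ × ℝ) × ((ℝ × ℝ) × (ℝ × ℝ))) => w.1.1 ^ 2 + w.2.1.1 ^ 2)
    measurable_const).inter (measurableSet_le measurable_const (by fun_prop : Measurable fun w : (ℝ × ℝ) × ((ℝ × ℝ) × ((ℝ × ℝ) × (ℝ × ℝ))) =>
      w.1.1 ^ 2 + w.2.1.1 ^ 2 + s * (w.2.2.1.1 ^ 2 + w.2.2.2.1 ^ 2)))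

/-- The majorant of the `x`-layer half of `Δ₂`: `𝟙_{layerW}(w)·𝟙{y₀² < 1}·𝟙_{box}(q)·g_r(q,w_J)·g_r(q,w_K)`. [folklore] -/
def rateΦB (s r : ℝ) (w : (ℝ × ℝ) × ((ℝ × ℝ) × ((ℝ × ℝ) × (ℝ × ℝ)))) : ℝ≥0∞ :=
  ((layerW s).indicator (fun _ => (1 : ℝ≥0∞)) w * {t : ℝ | t ^ 2 < 1}.indicator (fun _ => (1 : ℝ≥0∞)) w.1.2) *
    (sqBox.indicator (fun _ => (1 : ℝ≥0∞)) w.2.1 * (gq r w.2.1 w.2.2.1 * gq r w.2.1 w.2.2.2))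

/-- `rateΦB` is measurable. [folklore] -/
theorem measurable_rateΦB (s r : ℝ) : Measurable (rateΦB s r) := by
  unfold rateΦB
  exact ((measurable_const.indicator (measurableSet_layerW s)).mul
    ((measurable_const.indicator measurableSet_sqLine).comp (measurable_snd.comp measurable_fst))).mul
    ((measurable_Fdom_inner r).comp measurable_snd)

/-- ★ **The `x`-layer half of `Δ₂` under the majorant**: `𝟙_{layer s}(x)𝟙{N_0(y)<1}e^{−gexp} ≤ rateΦB ∘ pairCoord`. [folklore] -/
theorem layerX_le_rateΦB (s r : ℝ) (z : ℍ × ℍ) :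
    ((layer s).indicator (fun _ => (1 : ℝ≥0∞)) z.1) * ({y : ℍ | y.re ^ 2 + y.imI ^ 2 < 1}.indicator (fun _ => (1 : ℝ≥0∞)) z.2) *
        ENNReal.ofReal (Real.exp (-(gexp r z.1 z.2))) ≤ rateΦB s r (pairCoord z) := by
  by_cases hx : z.1 ∈ layer s
  swap
  · rw [indicator_of_notMem hx, zero_mul, zero_mul]; exact bot_le
  by_cases hy : z.2.re ^ 2 + z.2.imI ^ 2 < 1
  swap
  · rw [indicator_of_notMem (show z.2 ∉ {y : ℍ | y.re ^ 2 + y.imI ^ 2 < 1} from hy), mul_zero, zero_mul]; exact bot_le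
  rw [indicator_of_mem hx, indicator_of_mem (show z.2 ∈ {y : ℍ | y.re ^ 2 + y.imI ^ 2 < 1} from hy), one_mul, one_mul]
  have hx' := (mem_layer s z.1).1 hx
  have hW : pairCoord z ∈ layerW s := hx'
  have h0' : (pairCoord z).1.2 ∈ {t : ℝ | t ^ 2 < 1} := by show z.2.re ^ 2 < 1; nlinarith [sq_nonneg z.2.imI]
  have hI : (z.1.imI, z.2.imI) ∈ sqBox :=
    ⟨by show z.1.imI ^ 2 < 1; nlinarith [sq_nonneg z.1.re, hx'.1], by show z.2.imI ^ 2 < 1; nlinarith [sq_nonneg z.2.re]⟩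
  unfold rateΦB
  rw [indicator_of_mem hW, indicator_of_mem h0', one_mul, one_mul, show (pairCoord z).2.1 = (z.1.imI, z.2.imI) from rfl,
    show (pairCoord z).2.2.1 = (z.1.imJ, z.2.imJ) from rfl, show (pairCoord z).2.2.2 = (z.1.imK, z.2.imK) from rfl,
    indicator_of_mem hI, one_mul, gq_def, gq_def, ← ENNReal.ofReal_mul (Real.exp_pos _).le, ← Real.exp_add, gexp_def]
  refine le_of_eq ?_
  congr 2
  dsimp only
  ring

/-! ## §3 The integral of `rateΦB`: the longitudinal pair innermost -/

/-- The `(x₀,y₀)`-section of `rateΦB` at fixed `(q, w_J, w_K)` is a product of two one-dimensional indicators times a constant. [folklore] -/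
theorem rateΦB_section (s r : ℝ) (p : ℝ × ℝ) (u : (ℝ × ℝ) × ((ℝ × ℝ) × (ℝ × ℝ))) :
    rateΦB s r (p, u) = ((Lset (u.1.1 ^ 2) (s * (u.2.1.1 ^ 2 + u.2.2.1 ^ 2))).indicator (fun _ => (1 : ℝ≥0∞)) p.1 *
      {t : ℝ | t ^ 2 < 1}.indicator (fun _ => (1 : ℝ≥0∞)) p.2) *
      (sqBox.indicator (fun _ => (1 : ℝ≥0∞)) u.1 * (gq r u.1 u.2.1 * gq r u.1 u.2.2)) := by
  unfold rateΦB
  congr 2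

/-- ★ The inner `(x₀,y₀)`-integral: `∫ rateΦB((x₀,y₀),u) d(x₀,y₀) ≤ 2·2(s·u_⊥)^p · 𝟙_{box}(q)·g·g` (`u_⊥ = x_J²+x_K²`, `0 < p ≤ 1/2`, `0 ≤ s`). [folklore] -/
theorem lintegral_rateΦB_section_le {s p : ℝ} (hs : 0 ≤ s) (hp : 0 < p) (hp2 : p ≤ 1 / 2) (r : ℝ) (u : (ℝ × ℝ) × ((ℝ × ℝ) × (ℝ × ℝ))) :
    ∫⁻ q : ℝ × ℝ, rateΦB s r (q, u) ≤ ENNReal.ofReal (2 * (s * (u.2.1.1 ^ 2 + u.2.2.1 ^ 2)) ^ p) * 2 *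
      (sqBox.indicator (fun _ => (1 : ℝ≥0∞)) u.1 * (gq r u.1 u.2.1 * gq r u.1 u.2.2)) := by
  simp_rw [rateΦB_section]
  have hL : Measurable fun t : ℝ => (Lset (u.1.1 ^ 2) (s * (u.2.1.1 ^ 2 + u.2.2.1 ^ 2))).indicator (fun _ => (1 : ℝ≥0∞)) t :=
    measurable_const.indicator (measurableSet_Lset _ _)
  have hB : Measurable fun t : ℝ => {t : ℝ | t ^ 2 < 1}.indicator (fun _ => (1 : ℝ≥0∞)) t := measurable_const.indicator measurableSet_sqLine
  have hLB : Measurable fun q : ℝ × ℝ => (Lset (u.1.1 ^ 2) (s * (u.2.1.1 ^ 2 + u.2.2.1 ^ 2))).indicator (fun _ => (1 : ℝ≥0∞)) q.1 *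
      {t : ℝ | t ^ 2 < 1}.indicator (fun _ => (1 : ℝ≥0∞)) q.2 := (hL.comp measurable_fst).mul (hB.comp measurable_snd)
  rw [lintegral_mul_const _ hLB, lintegral_volume_prod_mul hL hB,
    lintegral_indicator_const (measurableSet_Lset _ _), lintegral_indicator_const measurableSet_sqLine, volume_sqBox_one, one_mul, one_mul]
  refine mul_le_mul' (mul_le_mul' (volume_Lset_le (sq_nonneg _) (by positivity) hp hp2) le_rfl) le_rfl

/-- The moment step: `(s·(x_J²+x_K²))^p·g(q,w_J)g(q,w_K) ≤ s^p·gqW_p(q,w_J)·gqW_p(q,w_K)`. [folklore] -/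
theorem layer_moment_le {s p : ℝ} (hs : 0 ≤ s) (hp : 0 < p) (r : ℝ) (q wJ wK : ℝ × ℝ) :
    ENNReal.ofReal ((s * (wJ.1 ^ 2 + wK.1 ^ 2)) ^ p) * (gq r q wJ * gq r q wK) ≤ ENNReal.ofReal (s ^ p) * (gqW p r q wJ * gqW p r q wK) := by
  rw [gqW_def, gqW_def, Real.mul_rpow hs (by positivity), ENNReal.ofReal_mul (Real.rpow_nonneg hs _)]
  have hmom : (wJ.1 ^ 2 + wK.1 ^ 2) ^ p ≤ (1 + (wJ.1 ^ 2 + wJ.2 ^ 2)) ^ p * (1 + (wK.1 ^ 2 + wK.2 ^ 2)) ^ p := by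
    rw [← Real.mul_rpow (by positivity) (by positivity)]
    refine Real.rpow_le_rpow (by positivity) ?_ hp.le
    nlinarith [sq_nonneg wJ.1, sq_nonneg wJ.2, sq_nonneg wK.1, sq_nonneg wK.2, mul_nonneg (add_nonneg (sq_nonneg wJ.1) (sq_nonneg wJ.2))
      (add_nonneg (sq_nonneg wK.1) (sq_nonneg wK.2))]
  have h2 : ENNReal.ofReal ((wJ.1 ^ 2 + wK.1 ^ 2) ^ p) ≤
      ENNReal.ofReal ((1 + (wJ.1 ^ 2 + wJ.2 ^ 2)) ^ p) * ENNReal.ofReal ((1 + (wK.1 ^ 2 + wK.2 ^ 2)) ^ p) := by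
    rw [← ENNReal.ofReal_mul (Real.rpow_nonneg (by positivity) _)]; exact ENNReal.ofReal_le_ofReal hmom
  calc ENNReal.ofReal (s ^ p) * ENNReal.ofReal ((wJ.1 ^ 2 + wK.1 ^ 2) ^ p) * (gq r q wJ * gq r q wK)
      ≤ ENNReal.ofReal (s ^ p) * (ENNReal.ofReal ((1 + (wJ.1 ^ 2 + wJ.2 ^ 2)) ^ p) * ENNReal.ofReal ((1 + (wK.1 ^ 2 + wK.2 ^ 2)) ^ p)) *
          (gq r q wJ * gq r q wK) := mul_le_mul' (mul_le_mul' le_rfl h2) le_rfl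
    _ = _ := by ring

/-- ★★ **THE INTEGRAL OF `rateΦB`**: `∫ rateΦB ≤ 4·s^p · 16(r²)^{−2p}·(π²/48)(r²)^{−4/3}·I(1/3)²` (`0 ≤ s`, `0 < r² ≤ 1`, `0 < p ≤ 1/2`). [folklore] -/
theorem lintegral_rateΦB_le {s p r : ℝ} (hs : 0 ≤ s) (hr : 0 < r) (hr1 : r ^ 2 ≤ 1) (hp : 0 < p) (hp2 : p ≤ 1 / 2) :
    ∫⁻ w, rateΦB s r w ≤ 4 * ENNReal.ofReal (s ^ p) *
      (ENNReal.ofReal (16 * ((r ^ 2) ^ (-p)) ^ 2) * (ENNReal.ofReal (Real.pi ^ 2 / 48 * (r ^ 2) ^ (-(4/3 : ℝ))) * (Ising (1/3) * Ising (1/3)))) := by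
  -- the longitudinal pair innermost
  rw [Measure.volume_eq_prod, lintegral_prod_symm _ (measurable_rateΦB s r).aemeasurable]
  have hmeasA : Measurable fun u : (ℝ × ℝ) × ((ℝ × ℝ) × (ℝ × ℝ)) => sqBox.indicator (fun _ => (1 : ℝ≥0∞)) u.1 * (gqW p r u.1 u.2.1 * gqW p r u.1 u.2.2) := by
    have hi : Measurable fun q : ℝ × ℝ => sqBox.indicator (fun _ => (1 : ℝ≥0∞)) q := measurable_const.indicator measurableSet_sqBox
    exact (hi.comp measurable_fst).mul (((measurable_gqW p r).comp (measurable_fst.prodMk (measurable_fst.comp measurable_snd))).mul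
      ((measurable_gqW p r).comp (measurable_fst.prodMk (measurable_snd.comp measurable_snd))))
  calc ∫⁻ u : (ℝ × ℝ) × ((ℝ × ℝ) × (ℝ × ℝ)), ∫⁻ q : ℝ × ℝ, rateΦB s r (q, u)
      ≤ ∫⁻ u : (ℝ × ℝ) × ((ℝ × ℝ) × (ℝ × ℝ)), 4 * ENNReal.ofReal (s ^ p) *
          (sqBox.indicator (fun _ => (1 : ℝ≥0∞)) u.1 * (gqW p r u.1 u.2.1 * gqW p r u.1 u.2.2)) := by
        refine lintegral_mono fun u => (lintegral_rateΦB_section_le hs hp hp2 r u).trans ?_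
        have hm := layer_moment_le hs hp r u.1 u.2.1 u.2.2
        calc ENNReal.ofReal (2 * (s * (u.2.1.1 ^ 2 + u.2.2.1 ^ 2)) ^ p) * 2 * (sqBox.indicator (fun _ => (1 : ℝ≥0∞)) u.1 * (gq r u.1 u.2.1 * gq r u.1 u.2.2))
            = 4 * sqBox.indicator (fun _ => (1 : ℝ≥0∞)) u.1 * (ENNReal.ofReal ((s * (u.2.1.1 ^ 2 + u.2.2.1 ^ 2)) ^ p) * (gq r u.1 u.2.1 * gq r u.1 u.2.2)) := by
              rw [ENNReal.ofReal_mul (by norm_num : (0:ℝ) ≤ 2), ENNReal.ofReal_ofNat]; ring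
          _ ≤ 4 * sqBox.indicator (fun _ => (1 : ℝ≥0∞)) u.1 * (ENNReal.ofReal (s ^ p) * (gqW p r u.1 u.2.1 * gqW p r u.1 u.2.2)) :=
              mul_le_mul' le_rfl hm
          _ = _ := by ring
    _ = 4 * ENNReal.ofReal (s ^ p) * ∫⁻ u : (ℝ × ℝ) × ((ℝ × ℝ) × (ℝ × ℝ)), sqBox.indicator (fun _ => (1 : ℝ≥0∞)) u.1 * (gqW p r u.1 u.2.1 * gqW p r u.1 u.2.2) :=
        lintegral_const_mul _ hmeasA
    _ ≤ _ := mul_le_mul' le_rfl (lintegral_rateΦA_inner_le hr hr1 hp (by linarith))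

/-! ## §4 The `y`-layer half by symmetry, and the integral of `Δ₂` -/

/-- `gexp` is symmetric in the two letters. [folklore] -/
theorem gexp_comm (r : ℝ) (x y : ℍ) : gexp r x y = gexp r y x := by
  rw [gexp_def, gexp_def]; ring

/-- The `x`-layer half of `Δ₂` as a function on `ℍ × ℍ`. [folklore] -/
def layerX (s r : ℝ) (z : ℍ × ℍ) : ℝ≥0∞ :=
  ((layer s).indicator (fun _ => (1 : ℝ≥0∞)) z.1) * ({y : ℍ | y.re ^ 2 + y.imI ^ 2 < 1}.indicator (fun _ => (1 : ℝ≥0∞)) z.2) *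
    ENNReal.ofReal (Real.exp (-(gexp r z.1 z.2)))

/-- `layer s` is measurable. [folklore] -/
theorem measurableSet_layer (s : ℝ) : MeasurableSet (layer s) := by
  have e : layer s = {x : ℍ | x.re ^ 2 + x.imI ^ 2 < 1} ∩ {x : ℍ | 1 ≤ x.re ^ 2 + x.imI ^ 2 + s * (x.imJ ^ 2 + x.imK ^ 2)} := by
    ext x; rw [mem_layer]; rfl
  rw [e]
  exact (measurableSet_lt (by fun_prop) measurable_const).inter (measurableSet_le measurable_const (by fun_prop))

/-- `gexp` is measurable on `ℍ × ℍ`. [folklore] -/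
theorem measurable_gexp (r : ℝ) : Measurable fun z : ℍ × ℍ => gexp r z.1 z.2 := by
  have : (fun z : ℍ × ℍ => gexp r z.1 z.2) = fun z => 4 * (r ^ 2 * (z.1.imJ ^ 2 + z.1.imK ^ 2 + z.2.imJ ^ 2 + z.2.imK ^ 2) +
      ((z.1.imK * z.2.imI - z.1.imI * z.2.imK) ^ 2 + (z.1.imI * z.2.imJ - z.1.imJ * z.2.imI) ^ 2)) := by
    funext z; rw [gexp_def]
  rw [this]; fun_prop

/-- `layerX` is measurable. [folklore] -/
theorem measurable_layerX (s r : ℝ) : Measurable (layerX s r) := by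
  have hS : MeasurableSet {x : ℍ | x.re ^ 2 + x.imI ^ 2 < 1} := measurableSet_lt (by fun_prop) measurable_const
  unfold layerX
  exact (((measurable_const.indicator (measurableSet_layer s)).comp measurable_fst).mul
    ((measurable_const.indicator hS).comp measurable_snd)).mul
    (ENNReal.measurable_ofReal.comp (Real.measurable_exp.comp (measurable_gexp r).neg))

/-- `Δ₂ = layerX + layerX ∘ swap`. [folklore] -/
theorem rateΔ₂_eq_layerX_add (s r : ℝ) (z : ℍ × ℍ) : rateΔ₂ s r z.1 z.2 = layerX s r z + layerX s r z.swap := by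
  rw [rateΔ₂_def, layerX, layerX, Prod.fst_swap, Prod.snd_swap, gexp_comm r z.2 z.1]; ring

/-- ★ `∫∫ layerX ≤ 4·s^p·(transverse block)` (`0 ≤ s`, `0 < r² ≤ 1`, `0 < p ≤ 1/2`). [folklore] -/
theorem lintegral_layerX_le {s p r : ℝ} (hs : 0 ≤ s) (hr : 0 < r) (hr1 : r ^ 2 ≤ 1) (hp : 0 < p) (hp2 : p ≤ 1 / 2) :
    ∫⁻ z, layerX s r z ∂((volume : Measure ℍ).prod volume) ≤ 4 * ENNReal.ofReal (s ^ p) *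
      (ENNReal.ofReal (16 * ((r ^ 2) ^ (-p)) ^ 2) * (ENNReal.ofReal (Real.pi ^ 2 / 48 * (r ^ 2) ^ (-(4/3 : ℝ))) * (Ising (1/3) * Ising (1/3)))) := by
  calc ∫⁻ z, layerX s r z ∂((volume : Measure ℍ).prod volume)
      ≤ ∫⁻ z, rateΦB s r (pairCoord z) ∂((volume : Measure ℍ).prod volume) := lintegral_mono fun z => layerX_le_rateΦB s r z
    _ = ∫⁻ w, rateΦB s r w := measurePreserving_pairCoord.lintegral_comp (measurable_rateΦB s r)
    _ ≤ _ := lintegral_rateΦB_le hs hr hr1 hp hp2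

/-- ★★ **THE INTEGRAL OF THE LAYER TERM `Δ₂`**: `∫∫ Δ₂ ≤ 2·4·s^p·16(r²)^{−2p}·(π²/48)(r²)^{−4/3}·I(1/3)²` (`0 ≤ s`, `0 < r² ≤ 1`, `0 < p ≤ 1/2`).
[folklore] -/
theorem lintegral_rateΔ₂_le {s p r : ℝ} (hs : 0 ≤ s) (hr : 0 < r) (hr1 : r ^ 2 ≤ 1) (hp : 0 < p) (hp2 : p ≤ 1 / 2) :
    ∫⁻ z, rateΔ₂ s r z.1 z.2 ∂((volume : Measure ℍ).prod volume) ≤ 2 * (4 * ENNReal.ofReal (s ^ p) *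
      (ENNReal.ofReal (16 * ((r ^ 2) ^ (-p)) ^ 2) * (ENNReal.ofReal (Real.pi ^ 2 / 48 * (r ^ 2) ^ (-(4/3 : ℝ))) * (Ising (1/3) * Ising (1/3))))) := by
  simp_rw [rateΔ₂_eq_layerX_add]
  rw [lintegral_add_left (measurable_layerX s r)]
  have hswap : ∫⁻ z, layerX s r z.swap ∂((volume : Measure ℍ).prod volume) = ∫⁻ z, layerX s r z ∂((volume : Measure ℍ).prod volume) :=
    lintegral_prod_swap (layerX s r)
  rw [hswap, two_mul]
  exact add_le_add (lintegral_layerX_le hs hr hr1 hp hp2) (lintegral_layerX_le hs hr hr1 hp hp2)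

end Summit.QuantumFields.YangMills.Theorems.SwapVirialDeficit.ZeroModeGroup

end
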